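import Literature.MathematicalPhysics.QuantumManyBody.PeriodicFeynmanKacFormUpper
import Mathlib.Analysis.InnerProductSpace.Calculus
import Mathlib.MeasureTheory.Integral.IntervalIntegral.Basic
import HarnessLib

/-!
# Route `BECConjugateDomination`, support item `PositiveMinimiser` (stmt-AtomisticToContinuum-11787):
# vocabulary of the regularity proof

Route-posited technical objects (D-0016 `<Route>…Defs` file) used by the proof that the periodic
`N`-body energy has a `C³`, finite-energy, strictly positive minimiser: the Feynman–Kac ground state
`Ψ₀` of `H = -Δ + W` on the torus (`W = ∑_{i<j} v^per(xᵢ - xⱼ) ∈ C²`) satisfies the Duhamel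
identity `Ψ₀ = P_T Ψ₀ - ∫₀ᵀ P_s ((W - E₀) Ψ₀) ds` for the FREE heat operator `P_t`, and each
application of `P_t` / `∫₀ᵀ P_s · ds` gains one continuous derivative (Gaussian kernel), which
bootstraps `Ψ₀ ∈ C⁰ ⇒ C¹ ⇒ C² ⇒ C³`. The objects, over the tree's Wiener space
(`wienerPaths N`, `displacement t ω = √2 b_t(ω)` of `GroundStateFeynmanKacDisplacement.lean`), for
functions with values in a real normed space `E` (we need `E = ℝ` and the iterated derivative
spaces `(ℝ³)^N →L[ℝ] ⋯`):

* `heatOp t f X = E[f(X + √2 b_t)]` — the free heat operator `P_t = e^{tΔ}`; `heatOpR s = P_{s⁺}`;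
* `duhamel T f X = ∫₀ᵀ P_s f (X) ds` — the time-integrated free flow;
* `gaussKer t Z = ∏ᵢₖ φ_{2t}(Z i k)` — the free heat kernel `p(2t; 0, Z)` (real form), with its
  normalisation `gaussC N t = (4πt)^{-3N/2}` and `sqn Z = ∑ᵢ ‖Z i‖²` (`gaussKer = gaussC·e^{-sqn/4t}`);
* `cfgInner Z : h ↦ ∑ᵢ ⟪Z i, h i⟫` — the configuration pairing, and
  `heatGrad t f X = (2t)⁻¹ E[⟨√2 b_t, ·⟩ f(X + √2 b_t)]` — the Gaussian gradient, the derivative of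
  `P_t f` at `X`.

Nothing is asserted here beyond `rfl`-level unfolding lemmas; the analysis is in the proof files
`BECConjugateDominationPositiveMinimiser*.lean`. All objects are standard (Gaussian semigroup).
-/

noncomputable section

namespace Summit.AtomisticToContinuum.BoseEinsteinCondensation.Theorems.PositiveMinimiser

open MeasureTheory ProbabilityTheory
open scoped ENNReal NNReal InnerProductSpace
open Literature.MathematicalPhysics.QuantumManyBody.BoseGas

variable {N : ℕ} {E : Type} [NormedAddCommGroup E] [NormedSpace ℝ E]

/-- The **free heat operator** `(P_t f)(X) = E[f(X + √2 b_t)]` on `E`-valued functions of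
`(ℝ³)^N` (Bochner integral over the tree's `3N` Wiener coordinates; speed-`2` Brownian motion,
generator `Δ`, so `P_t = e^{tΔ}`). [folklore] -/
def heatOp (t : ℝ≥0) (f : Config N → E) (X : Config N) : E :=
  ∫ ω, f (X + displacement t ω) ∂wienerPaths N

/-- Real-time version of the free heat operator: `heatOpR s = P_{s⁺}` (the identity for `s ≤ 0`).
[folklore] -/
def heatOpR (s : ℝ) (f : Config N → E) (X : Config N) : E := heatOp s.toNNReal f X

/-- The **time-integrated free flow** `duhamel T f X = ∫₀ᵀ (P_s f)(X) ds` (interval integral),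
the Duhamel term of the identity `Ψ₀ = P_T Ψ₀ - duhamel T ((W - E₀)Ψ₀)`. [folklore] -/
def duhamel (T : ℝ) (f : Config N → E) (X : Config N) : E :=
  ∫ s in (0 : ℝ)..T, heatOpR s f X

/-- The **free heat kernel at the origin**, `gaussKer t Z = ∏ᵢₖ φ_{2t}(Z i k) = p(2t; 0, Z)`, the
density of the displacement `√2 b_t` with respect to Lebesgue measure on `(ℝ³)^N` (real form of the
tree's `∏ gaussianPDF`). [folklore] -/
def gaussKer (t : ℝ≥0) (Z : Config N) : ℝ := ∏ i, ∏ k, gaussianPDFReal 0 (2 * t) (Z i k)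

/-- The Gaussian normalisation constant `(4πt)^{-3N/2}`, in product form. [folklore] -/
def gaussC (N : ℕ) (t : ℝ≥0) : ℝ := ∏ _i : Fin N, ∏ _k : Fin 3, (Real.sqrt (2 * Real.pi * (2 * t)))⁻¹

/-- `sqn Z = ∑ᵢ ‖Z i‖²`, the Euclidean squared norm of all `3N` coordinates
(`gaussKer t Z = gaussC N t · exp(-sqn Z/(4t))`). [folklore] -/
def sqn (Z : Config N) : ℝ := ∑ i, ‖Z i‖ ^ 2

/-- The **configuration pairing** `cfgInner Z : h ↦ ∑ᵢ ⟪Z i, h i⟫_{ℝ³}`, a continuous linear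
functional on `(ℝ³)^N` (the gradient of `sqn/2`). [folklore] -/
def cfgInner (Z : Config N) : Config N →L[ℝ] ℝ :=
  ∑ i, (innerSL ℝ (Z i)).comp (ContinuousLinearMap.proj i)

/-- The **Gaussian gradient** `heatGrad t f X = (2t)⁻¹ E[⟨√2 b_t, ·⟩ f(X + √2 b_t)]`, a continuous
linear map `(ℝ³)^N →L[ℝ] E`: the derivative of `P_t f` at `X` for bounded continuous `f`
(Gaussian integration by parts / Bismut formula in its simplest form). [folklore] -/
def heatGrad (t : ℝ≥0) (f : Config N → E) (X : Config N) : Config N →L[ℝ] E :=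
  ((2 * (t : ℝ))⁻¹ : ℝ) •
    (∫ ω : PathSpace N, (cfgInner (N := N) (displacement t ω)).smulRight (f (X + displacement t ω))
      ∂wienerPaths N : Config N →L[ℝ] E)

/-! ### Unfolding lemmas -/

omit [NormedSpace ℝ E] in
/-- `cfgInner Z h = ∑ᵢ ⟪Z i, h i⟫`. [folklore] -/
@[simp] theorem cfgInner_apply (Z h : Config N) : cfgInner Z h = ∑ i, ⟪Z i, h i⟫_ℝ := by
  simp [cfgInner]

/-- `heatOpR s = P_s` for `s = t ≥ 0`. [folklore] -/
theorem heatOpR_coe (t : ℝ≥0) (f : Config N → E) (X : Config N) :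
    heatOpR (t : ℝ) f X = heatOp t f X := by
  rw [heatOpR, Real.toNNReal_coe]

end Summit.AtomisticToContinuum.BoseEinsteinCondensation.Theorems.PositiveMinimiser

end
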